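import Summits.ResolutionOfSingularities.ResolutionOfSingularities.Theorems.EquisingularLiftEquisingularLiftNatResidueHypDefs8
import Summits.ResolutionOfSingularities.ResolutionOfSingularities.Theorems.EquisingularLiftEquisingularLiftNatLetteredPrefixResolution
import HarnessLib

/-!
# [OURS · L1 W4.5(b) · EL♮(3) · SPEC K6 v10 — THE K6-2P6 JUNCTION OVER THE TREE NAMES] `letteredPrefix_end_of_isoHypReachNDLeavesP6`

res-L1-w45b-idea-1 g27 (IDEATOR 1; SPEC custody) · 2026-08-28 · supersedes `Cruxes/EquisingularLiftNatThree/NDLeavesRungK6JunctionV11.lean` 23ddb5e0ba5f0b9c (same lemmas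
over a COPY of the text; now over the TREE declarations ✓ p671016 Defs8 `PrefixReachKeyLetterParam` / `PrefixReachKeyLetterP6` / `IsoHypReachNDLeavesP6` and ✓ p669625
the K5⁶ engine).  OURS · counted 0 · AI-written, weaker than expert review · nothing of [Hironaka2017] asserted · **EL♮(3) NOT proved** · pure logic; no `sorry`,
no instance, no notation.  Cruxes modules are not built library targets: lead-2 (RUNG⁶ pen) COPIES §B/§D (≈ 60 lines) into `…NatNDLeavesRungP6.lean` or re-proves
them inline — the point of this file is that they ELABORATE against the tree as it stands tonight.

* §B `prefixReachKeyLetterParam_mono_reach` (monotone in `Reach`: Defs8's `Reach := B‴` feeds the engine's `Reach := B‴ ∨ toric` by `Or.inl`),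
  `prefixReachKeyLetterParam_then_rounds` (PREFIX at `(F, ρ, T)` + ND rounds `hQ'` ⇒ PREFIX at `(F', ρ', T')` for `Reach ⊇ toric`: `hQ'` applied ONCE to the
  collapsed motive `∃ Ls Kp, Q … Ls Kp`, whose `ND.RoundClosed`ness is READ OFF clause (Pc) — SPEC-K6-v10-PLAN §3 (R1)/(R2) hold for the landed text),
  `prefixReachKeyLetterParam_end_of_prefix_then_rounds` (both in one term);
* §D **`letteredPrefix_end_of_isoHypReachNDLeavesP6`** — from the ROUND FACTS `ND.RoundFacts n k (ND.NDInvCLNP n k)` (K6-2P5's `hround`, supplied at n = 3 by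
  ✓ `ndInvLNP_round 3 k`) and the BLOB `IsoHypReachNDLeavesP6 k n H ι`: the engine's LAST HYPOTHESIS literally —
  `∃ F' ρ' T', PrefixReachKeyLetterParam k n H ι (B‴ ∨ toric) (ReachTowerBQuintPrime ℙⁿ) (HyperplaneLetters k n H ι) (OpeningCertKeyLetter k n H ι) F' ρ' T' ∧ T̃' regular`
  (via ✓ `ND.rounds_resolve`, exactly as K6-2P5 l.193);
* §E PROBE (kernel): `target_elnat_of_letteredPrefixResolution p hp k n H ι hι hH hloc (B‴ ∨ toric) (ReachTowerBQuintPrime ℙⁿ) (HyperplaneLetters …) (OpeningCertKeyLetter …)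
  HSUB₁ HSUB₂ HPT HOPEN HPAIR HROUND (letteredPrefix_end_of_isoHypReachNDLeavesP6 hround h) : ELNatConclusionO k n H ι` ELABORATES with the six suppliers as opaque
  binders — i.e. **RUNG⁶ = this term + the supplier plumbing** (HSUB₁ := K6-2P5's `Or.elim` block with ✓ `hsub_reachTowerBTriplePrime_of_fact_full` / ✓ `ND.hsub_strataLift`,
  HSUB₂ := ✓ p655307 composite, HPT := ✓ p670621 `TCPlus.hpt6_supplier`, HPAIR := ✓ p670305 `TCPlus.hpair_supplier_of …`, HROUND := ✓ `TCPlus.hround_seam k hF`,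
  HOPEN := the one open supplier).
-/

set_option linter.dupNamespace false -- mandated namespace of this single-conjunct summit

noncomputable section

open CategoryTheory CategoryTheory.Limits AlgebraicGeometry TopologicalSpace Topology
open Literature.AlgebraicGeometry.Resolution
open AlgebraicGeometry.Scheme.IdealSheafData
open Summit.ResolutionOfSingularities.ResolutionOfSingularities.Cruxes.EquisingularLiftNat.Sections

namespace Summit.ResolutionOfSingularities.ResolutionOfSingularities.Cruxes.EquisingularLiftNatThree.ToricTowers.K6Junction.Defs8

variable {k : Type} [Field k] [IsAlgClosed k] {n : ℕ} {H : AlgebraicGeometry.Scheme.{0}}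
  {ι : H ⟶ (Literature.AlgebraicGeometry.Motives.projectiveSpace n k).left}
  {Reach Reach₁ Reach₂ : ∀ (F₁ F₂ : AlgebraicGeometry.Scheme.{0}), (F₂ ⟶ F₁) → F₁ → Set F₂ → ∀ (F₉ : AlgebraicGeometry.Scheme.{0}), (F₉ ⟶ F₂) → Set F₉ → Prop}
  {ReachL : ∀ (F₂ : AlgebraicGeometry.Scheme.{0}), (F₂ ⟶ (Literature.AlgebraicGeometry.Motives.projectiveSpace n k).left) →
      (Literature.AlgebraicGeometry.Motives.projectiveSpace n k).left → Set F₂ → List (Set F₂) → ∀ (F₉ : AlgebraicGeometry.Scheme.{0}), (F₉ ⟶ F₂) → Set F₉ → Prop}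
  {LS : ∀ (F₂ : AlgebraicGeometry.Scheme.{0}), (F₂ ⟶ (Literature.AlgebraicGeometry.Motives.projectiveSpace n k).left) →
      (Literature.AlgebraicGeometry.Motives.projectiveSpace n k).left → List (Set F₂) → Prop}
  {Open : ∀ (F₃ : AlgebraicGeometry.Scheme.{0}), (F₃ ⟶ (Literature.AlgebraicGeometry.Motives.projectiveSpace n k).left) → Set F₃ → List (Set F₃) →
      Option (Set F₃ × Set F₃ × Set F₃) → Prop}
  {F F' : AlgebraicGeometry.Scheme.{0}} {ρ : F ⟶ (Literature.AlgebraicGeometry.Motives.projectiveSpace n k).left} {T : Set F}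
  {ρ' : F' ⟶ (Literature.AlgebraicGeometry.Motives.projectiveSpace n k).left} {T' : Set F'}

/-! ## §B  Junction lemmas over `PrefixReachKeyLetterParam` -/

/-- **Monotonicity in `Reach`** (a motive closed under (Pc)[`Reach₂`] is closed under (Pc)[`Reach₁`] when `Reach₁ ≤ Reach₂`). [OURS · pure logic] -/
theorem prefixReachKeyLetterParam_mono_reach
    (hR : ∀ (F₁ F₂ : AlgebraicGeometry.Scheme.{0}) (υ : F₂ ⟶ F₁) (x : F₁) (T₂ : Set F₂) (F₉ : AlgebraicGeometry.Scheme.{0}) (β : F₉ ⟶ F₂) (T₉ : Set F₉),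
      Reach₁ F₁ F₂ υ x T₂ F₉ β T₉ → Reach₂ F₁ F₂ υ x T₂ F₉ β T₉)
    (hpre : PrefixReachKeyLetterParam k n H ι Reach₁ ReachL LS Open F ρ T) :
    PrefixReachKeyLetterParam k n H ι Reach₂ ReachL LS Open F ρ T := by
  intro Q hstart hD hPc hPL hi hO hii hHR
  refine hpre Q hstart hD ?_ hPL hi hO hii hHR
  intro F₁ F₂ ρ₁ T₁ Ls Kp x υ hx hQ hn hr hυ
  obtain ⟨h₁, h₂⟩ := hPc F₁ F₂ ρ₁ T₁ Ls Kp x υ hx hQ hn hr hυ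
  exact ⟨h₁, fun F₉ β T₉ h₉ => h₂ F₉ β T₉ (hR _ _ _ _ _ _ _ _ h₉)⟩

/-- **PREFIX then ND ROUNDS ⇒ PREFIX at the resolved end**, for any `Reach ⊇ ND.ReachToric n`; `hQ'` is ✓ `ND.rounds_resolve`'s first conjunct between the prefix's END
stage and the resolved stage.  Inside the `∀ Q`: `hQ'` applied to the COLLAPSED motive `∃ Ls Kp, Q … Ls Kp`, which is `ND.RoundClosed` by clause (Pc). [OURS · pure logic] -/
theorem prefixReachKeyLetterParam_then_rounds
    (hRT : ∀ (F₁ F₂ : AlgebraicGeometry.Scheme.{0}) (υ : F₂ ⟶ F₁) (x : F₁) (T₂ : Set F₂) (F₉ : AlgebraicGeometry.Scheme.{0}) (β : F₉ ⟶ F₂) (T₉ : Set F₉),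
      ND.ReachToric n F₁ F₂ υ x T₂ F₉ β T₉ → Reach F₁ F₂ υ x T₂ F₉ β T₉)
    (hpre : PrefixReachKeyLetterParam k n H ι Reach ReachL LS Open F ρ T)
    (hQ' : ∀ Q₃ : (∀ F₁ : AlgebraicGeometry.Scheme.{0}, (F₁ ⟶ (Literature.AlgebraicGeometry.Motives.projectiveSpace n k).left) → Set F₁ → Prop),
      ND.RoundClosed n k Q₃ → Q₃ F ρ T → Q₃ F' ρ' T') :
    PrefixReachKeyLetterParam k n H ι Reach ReachL LS Open F' ρ' T' := by
  intro Q hstart hD hPc hPL hi hO hii hHR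
  refine hQ' (fun F₁ ρ₁ T₁ => ∃ (Ls : List (Set F₁)) (Kp : Option (Set F₁ × Set F₁ × Set F₁)), Q F₁ ρ₁ T₁ Ls Kp) ?_ (hpre Q hstart hD hPc hPL hi hO hii hHR)
  intro F₁ F₂ ρ₁ T₁ x υ hx hQx hn hr hυ
  obtain ⟨Ls, Kp, hQx⟩ := hQx
  obtain ⟨h₁, h₂⟩ := hPc F₁ F₂ ρ₁ T₁ Ls Kp x υ hx hQx hn hr hυ
  exact ⟨⟨[], none, h₁⟩, fun F₉ β T₉ h₉ => ⟨[], none, h₂ F₉ β T₉ (hRT _ _ _ _ _ _ _ _ h₉)⟩⟩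

/-- Both in one term: prefix at `Reach₁` + rounds ⇒ prefix at `Reach₂ ⊇ Reach₁ ∪ toric` at the resolved end. [OURS · pure logic] -/
theorem prefixReachKeyLetterParam_end_of_prefix_then_rounds
    (hR : ∀ (F₁ F₂ : AlgebraicGeometry.Scheme.{0}) (υ : F₂ ⟶ F₁) (x : F₁) (T₂ : Set F₂) (F₉ : AlgebraicGeometry.Scheme.{0}) (β : F₉ ⟶ F₂) (T₉ : Set F₉),
      Reach₁ F₁ F₂ υ x T₂ F₉ β T₉ → Reach₂ F₁ F₂ υ x T₂ F₉ β T₉)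
    (hRT : ∀ (F₁ F₂ : AlgebraicGeometry.Scheme.{0}) (υ : F₂ ⟶ F₁) (x : F₁) (T₂ : Set F₂) (F₉ : AlgebraicGeometry.Scheme.{0}) (β : F₉ ⟶ F₂) (T₉ : Set F₉),
      ND.ReachToric n F₁ F₂ υ x T₂ F₉ β T₉ → Reach₂ F₁ F₂ υ x T₂ F₉ β T₉)
    (hpre : PrefixReachKeyLetterParam k n H ι Reach₁ ReachL LS Open F ρ T)
    (hQ' : ∀ Q₃ : (∀ F₁ : AlgebraicGeometry.Scheme.{0}, (F₁ ⟶ (Literature.AlgebraicGeometry.Motives.projectiveSpace n k).left) → Set F₁ → Prop),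
      ND.RoundClosed n k Q₃ → Q₃ F ρ T → Q₃ F' ρ' T') :
    PrefixReachKeyLetterParam k n H ι Reach₂ ReachL LS Open F' ρ' T' :=
  prefixReachKeyLetterParam_then_rounds hRT (prefixReachKeyLetterParam_mono_reach hR hpre) hQ'

/-! ## §D  The K6-2P6 junction: blob + round facts ⇒ the engine's last hypothesis -/

variable (k n H ι) in
/-- **`letteredPrefix_end_of_isoHypReachNDLeavesP6`** — from the ND ROUND FACTS (K6-2P5's `hround`; at `n = 3` ✓ `ndInvLNP_round 3 k`) and the BLOB `IsoHypReachNDLeavesP6 k n H ι`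
(✓ p671016): a resolved end reached by the KEY-LETTER PREFIX for the engine's reach `B‴ ∨ toric` — literally the last hypothesis of ✓ p669625
`target_elnat_of_letteredPrefixResolution` at `ReachL := ReachTowerBQuintPrime ℙⁿ`, `LS := HyperplaneLetters`, `Open := OpeningCertKeyLetter`. [OURS · pure logic over ✓ `ND.rounds_resolve`] -/
theorem letteredPrefix_end_of_isoHypReachNDLeavesP6 (hround : ND.RoundFacts n k (ND.NDInvCLNP n k)) (h : IsoHypReachNDLeavesP6 k n H ι) :
    ∃ (F' : AlgebraicGeometry.Scheme.{0}) (ρ' : F' ⟶ (Literature.AlgebraicGeometry.Motives.projectiveSpace n k).left) (T' : Set F'),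
      PrefixReachKeyLetterParam k n H ι
          (fun F₁ F₂ υ x T₂ F₉ β T₉ => ReachTowerBTriplePrime F₁ F₂ υ x T₂ F₉ β T₉ ∨ ND.ReachToric n F₁ F₂ υ x T₂ F₉ β T₉)
          (ReachTowerBQuintPrime (Literature.AlgebraicGeometry.Motives.projectiveSpace n k).left) (HyperplaneLetters k n H ι) (OpeningCertKeyLetter k n H ι) F' ρ' T' ∧
        Literature.AlgebraicGeometry.Resolution.Scheme.IsRegular
          (AlgebraicGeometry.Scheme.IdealSheafData.vanishingIdeal (⟨closure T', isClosed_closure⟩ : TopologicalSpace.Closeds F')).subscheme := by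
  obtain ⟨F, ρ, T, m, hpre, hND⟩ := h
  -- the ND rounds from the prefix's END STAGE (K6-2P5 l.193 VERBATIM)
  obtain ⟨F', ρ', T', hQ', hreg'⟩ := ND.rounds_resolve n k (ND.NDInvCLNP n k) (ND.ndInvCLNP_end n k) hround m F ρ T hND
  exact ⟨F', ρ', T', prefixReachKeyLetterParam_end_of_prefix_then_rounds (Reach₁ := ReachTowerBTriplePrime)
    (fun _ _ _ _ _ _ _ _ h₁ => Or.inl h₁) (fun _ _ _ _ _ _ _ _ h₂ => Or.inr h₂) hpre hQ', hreg'⟩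

/-! ## §E  PROBE (kernel): RUNG⁶ = the engine applied to §D, the six suppliers opaque -/

example : True := by
  have _rung6_modulo_suppliers := fun (p : ℕ) (hp : p.Prime) (k : Type) [Field k] [CharP k p] [IsAlgClosed k] (n : ℕ) (H : AlgebraicGeometry.Scheme.{0})
      (ι : H ⟶ (Literature.AlgebraicGeometry.Motives.projectiveSpace n k).left) (hι : AlgebraicGeometry.IsClosedImmersion ι) (hH : AlgebraicGeometry.IsIntegral H)
      (hloc : ∀ y : (Literature.AlgebraicGeometry.Motives.projectiveSpace n k).left, ∃ U : (Literature.AlgebraicGeometry.Motives.projectiveSpace n k).left.affineOpens,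
        y ∈ (U : (Literature.AlgebraicGeometry.Motives.projectiveSpace n k).left.Opens) ∧ (ι.ker.ideal U).IsPrincipal)
      HSUB₁ HSUB₂ HPT HOPEN HPAIR HROUND (hround : ND.RoundFacts n k (ND.NDInvCLNP n k)) (h : IsoHypReachNDLeavesP6 k n H ι) =>
    (@target_elnat_of_letteredPrefixResolution p hp k _ _ _ n H ι hι hH hloc
      (fun F₁ F₂ υ x T₂ F₉ β T₉ => ReachTowerBTriplePrime F₁ F₂ υ x T₂ F₉ β T₉ ∨ ND.ReachToric n F₁ F₂ υ x T₂ F₉ β T₉)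
      (ReachTowerBQuintPrime (Literature.AlgebraicGeometry.Motives.projectiveSpace n k).left) (HyperplaneLetters k n H ι) (OpeningCertKeyLetter k n H ι)
      HSUB₁ HSUB₂ HPT HOPEN HPAIR HROUND (letteredPrefix_end_of_isoHypReachNDLeavesP6 k n H ι hround h) : ELNatConclusionO k n H ι)
  trivial

#print axioms prefixReachKeyLetterParam_mono_reach
#print axioms prefixReachKeyLetterParam_then_rounds
#print axioms letteredPrefix_end_of_isoHypReachNDLeavesP6

end Summit.ResolutionOfSingularities.ResolutionOfSingularities.Cruxes.EquisingularLiftNatThree.ToricTowers.K6Junction.Defs8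

end
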